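/-
Solo seat `solo-Langlands-informed` (s7).  Kernel rung for LEMMA B of
`run/shared/lean/ideation/Langlands/solo-informed/paper/SelmerScarcity.md`
("Selmer scarcity at unit rank zero").  Classical; cf. F. Calegari – A. Venkatesh,
*A torsion Jacquet–Langlands correspondence*, Astérisque 409 (2019), remark before Lemma 118
(arXiv:1212.3847, p. 134).  No new mathematics is claimed; this file only makes the
scarcity input of the s7 note kernel-checked against Mathlib's `IsDedekindDomain.selmerGroup`.
-/
import Mathlib

/-!
# Selmer scarcity: triviality of `K(∅, n)` at unit rank zero

Let `R` be a Dedekind domain with fraction field `K` and `n ≥ 1`.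

* `toAdd_valuationOfNeZero_eq_neg_count` — the bridge between Mathlib's unit valuation
  `v.valuationOfNeZero : Kˣ →* Multiplicative ℤ` and the exponent `FractionalIdeal.count K v (x)`
  of `v` in the factorisation of the principal fractional ideal `(x)`.
* `exists_pow_eq_spanSingleton` — if `n ∣ ord_v (x)` for every `v`, then `(x) = 𝔞 ^ n`.
* `exists_units_smul_pow_eq` — if moreover `# Cl(R)` is prime to `n`, then `x = u • y ^ n`
  with `u ∈ Rˣ`.
* `exists_pow_eq_of_forall_dvd_count`, `selmerGroup_empty_eq_bot` — if moreover `Rˣ` is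
  `n`-divisible, then `x` is an `n`-th power in `Kˣ`; equivalently the Selmer group
  `K(∅, n) = ker (Kˣ/Kˣⁿ → ∏ᵥ ℤ/n)` is trivial.
* `NumberField.selmerGroup_empty_eq_bot_of_rank_eq_zero` — the number-field case used in the
  note: unit rank `0`, `n` prime to the class number and to the number of roots of unity.

For `F` imaginary quadratic and a prime `ℓ ∤ h_F · w_F` this is the statement
"an everywhere-locally-divisible class in `F^× / F^{×ℓ}` is trivial", i.e. the vanishing of the
unramified-away-from-`ℓ`, flat-at-`ℓ` Selmer group of `μ_ℓ` that drives Theorem 1 of the note.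
-/

namespace Summit.Langlands.Langlands.Theorems

open IsDedekindDomain IsDedekindDomain.HeightOneSpectrum FractionalIdeal
open scoped nonZeroDivisors

section Dedekind

variable {R : Type*} [CommRing R] [IsDedekindDomain R] {K : Type*} [Field K] [Algebra R K]
  [IsFractionRing R K]

/-- Bridge: Mathlib's (multiplicative, `≤ 1` on integers) unit valuation at `v`, read additively,
is minus the exponent of `v` in the factorisation of the principal fractional ideal `(x)`. -/
theorem toAdd_valuationOfNeZero_eq_neg_count (v : HeightOneSpectrum R) (x : Kˣ) :
    Multiplicative.toAdd (v.valuationOfNeZero x) = -count K v (spanSingleton R⁰ (x : K)) := by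
  classical
  have hx0 : spanSingleton R⁰ (x : K) ≠ 0 := spanSingleton_ne_zero_iff.mpr x.ne_zero
  have hden : algebraMap R K ((IsLocalization.sec R⁰ (x : K)).2 : R) ≠ 0 :=
    IsFractionRing.to_map_ne_zero_of_mem_nonZeroDivisors (SetLike.coe_mem _)
  have hfac : spanSingleton R⁰ (x : K) =
      spanSingleton R⁰ (algebraMap R K ((IsLocalization.sec R⁰ (x : K)).2 : R))⁻¹ *
        ((Ideal.span {(IsLocalization.sec R⁰ (x : K)).1} : Ideal R) : FractionalIdeal R⁰ K) := by
    rw [coeIdeal_span_singleton, spanSingleton_mul_spanSingleton]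
    congr 1
    rw [eq_inv_mul_iff_mul_eq₀ hden, mul_comm]
    exact IsLocalization.sec_spec (M := R⁰) (x : K)
  rw [count_well_defined K v hx0 hfac]
  simp only [valuationOfNeZero, MonoidHom.coe_mk, OneHom.coe_mk, valuationOfNeZeroToFun,
    toAdd_ofAdd]
  ring

/-- If every exponent in the factorisation of `(x)` is divisible by `n ≥ 1`, then `(x)` is the
`n`-th power of a fractional ideal. -/
theorem exists_pow_eq_spanSingleton {n : ℕ} (hn : 0 < n) (x : Kˣ)
    (h : ∀ v : HeightOneSpectrum R, (n : ℤ) ∣ count K v (spanSingleton R⁰ (x : K))) :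
    ∃ 𝔞 : FractionalIdeal R⁰ K, 𝔞 ^ n = spanSingleton R⁰ (x : K) := by
  classical
  have hx0 : spanSingleton R⁰ (x : K) ≠ 0 := spanSingleton_ne_zero_iff.mpr x.ne_zero
  have _ := hn
  -- exponents of the putative `n`-th root
  let e : HeightOneSpectrum R → ℤ := fun v => count K v (spanSingleton R⁰ (x : K)) / n
  have he : ∀ v, e v * n = count K v (spanSingleton R⁰ (x : K)) := fun v =>
    Int.ediv_mul_cancel (h v)
  have hf := finite_factors (K := K) (spanSingleton R⁰ (x : K))
  rw [Filter.eventually_cofinite] at hf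
  have hfin : Function.HasFiniteMulSupport
      (fun v : HeightOneSpectrum R => (v.asIdeal : FractionalIdeal R⁰ K) ^ e v) := by
    refine hf.subset fun v hv => ?_
    simp only [Function.mem_mulSupport, ne_eq, Set.mem_setOf_eq] at hv ⊢
    intro hc
    apply hv
    have : e v = 0 := by simp [e, hc]
    rw [this, zpow_zero]
  refine ⟨∏ᶠ v : HeightOneSpectrum R, (v.asIdeal : FractionalIdeal R⁰ K) ^ e v, ?_⟩
  rw [finprod_pow hfin n]
  conv_rhs => rw [← finprod_heightOneSpectrum_factorization' K hx0]
  refine finprod_congr fun v => ?_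
  rw [← zpow_natCast, ← zpow_mul, he v]

/-- If every exponent of `(x)` is divisible by `n ≥ 1` and the class group has order prime to
`n`, then `x = u • y ^ n` for a unit `u ∈ Rˣ` and some `y ∈ K`. -/
theorem exists_units_smul_pow_eq {n : ℕ} (hn : 0 < n)
    (hcop : (Nat.card (ClassGroup R)).Coprime n) (x : Kˣ)
    (h : ∀ v : HeightOneSpectrum R, (n : ℤ) ∣ count K v (spanSingleton R⁰ (x : K))) :
    ∃ (u : Rˣ) (y : K), u • y ^ n = (x : K) := by
  classical
  obtain ⟨𝔞, h𝔞⟩ := exists_pow_eq_spanSingleton hn x h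
  have hx0 : spanSingleton R⁰ (x : K) ≠ 0 := spanSingleton_ne_zero_iff.mpr x.ne_zero
  have h𝔞0 : 𝔞 ≠ 0 := by
    rintro rfl
    rw [zero_pow hn.ne'] at h𝔞
    exact hx0 h𝔞.symm
  -- the class of `𝔞` is `n`-torsion, hence trivial since `# Cl(R)` is prime to `n`
  have hA : ClassGroup.mk K (Units.mk0 𝔞 h𝔞0) ^ n = 1 := by
    rw [← map_pow, ClassGroup.mk_eq_one_iff]
    have hval : ((Units.mk0 𝔞 h𝔞0 ^ n : (FractionalIdeal R⁰ K)ˣ) : FractionalIdeal R⁰ K) =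
        spanSingleton R⁰ (x : K) := by
      rw [Units.val_pow_eq_pow_val, Units.val_mk0, h𝔞]
    rw [hval]
    exact (isPrincipal_iff _).mpr ⟨_, rfl⟩
  have hA1 : ClassGroup.mk K (Units.mk0 𝔞 h𝔞0) = 1 := by
    apply (powCoprime hcop).injective
    rw [powCoprime_apply, powCoprime_apply, one_pow, hA]
  rw [ClassGroup.mk_eq_one_iff] at hA1
  obtain ⟨y, hy⟩ := (isPrincipal_iff _).mp hA1
  rw [Units.val_mk0] at hy
  have hxy : spanSingleton R⁰ (y ^ n) = spanSingleton R⁰ (x : K) := by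
    rw [← spanSingleton_pow, ← hy, h𝔞]
  obtain ⟨u, hu⟩ := spanSingleton_eq_spanSingleton.mp hxy
  exact ⟨u, y, hu⟩

/-- **Selmer scarcity** (abstract form).  If `# Cl(R)` is prime to `n ≥ 1` and the unit group
`Rˣ` is `n`-divisible, then every `x ∈ Kˣ` all of whose valuations are divisible by `n` is an
`n`-th power in `Kˣ`. -/
theorem exists_pow_eq_of_forall_dvd_count {n : ℕ} (hn : 0 < n)
    (hcop : (Nat.card (ClassGroup R)).Coprime n) (hU : ∀ u : Rˣ, ∃ w : Rˣ, w ^ n = u)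
    (x : Kˣ) (h : ∀ v : HeightOneSpectrum R, (n : ℤ) ∣ count K v (spanSingleton R⁰ (x : K))) :
    ∃ y : Kˣ, y ^ n = x := by
  obtain ⟨u, y, hu⟩ := exists_units_smul_pow_eq hn hcop x h
  obtain ⟨w, rfl⟩ := hU u
  have hy0 : y ≠ 0 := by
    rintro rfl
    apply x.ne_zero
    rw [← hu, zero_pow hn.ne', smul_zero]
  refine ⟨Units.mk0 (algebraMap R K (w : R) * y)
    (mul_ne_zero (Units.map (algebraMap R K : R →* K) w).ne_zero hy0), ?_⟩
  ext
  rw [Units.val_pow_eq_pow_val, Units.val_mk0, mul_pow, ← map_pow, ← hu, Units.smul_def,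
    Algebra.smul_def, Units.val_pow_eq_pow_val]

/-- **Selmer scarcity** for Mathlib's Selmer group: under the same hypotheses the Selmer group
`K(∅, n) = {x ∈ Kˣ/Kˣⁿ : ord_v x ≡ 0 (mod n) for all v}` is trivial. -/
theorem selmerGroup_empty_eq_bot {n : ℕ} (hn : 0 < n)
    (hcop : (Nat.card (ClassGroup R)).Coprime n) (hU : ∀ u : Rˣ, ∃ w : Rˣ, w ^ n = u) :
    IsDedekindDomain.selmerGroup (R := R) (K := K) (S := (∅ : Set (HeightOneSpectrum R)))
      (n := n) = ⊥ := by
  classical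
  rw [eq_bot_iff]
  intro x hx
  induction x using QuotientGroup.induction_on with
  | H x =>
    rw [Subgroup.mem_bot, QuotientGroup.eq_one_iff]
    have hdiv : ∀ v : HeightOneSpectrum R, (n : ℤ) ∣ count K v (spanSingleton R⁰ (x : K)) := by
      intro v
      have h1 : v.valuationOfNeZeroMod n (x : Kˣ ⧸ (powMonoidHom n : Kˣ →* Kˣ).range) = 1 :=
        hx v (Set.notMem_empty v)
      -- unpack `valuationOfNeZeroMod` (Mathlib's definition abuses the defeq
      -- `Multiplicative ℤ ⧸ (nℤ).toSubgroup = Multiplicative (ℤ ⧸ nℤ)`, so we go through `rfl`)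
      have key : v.valuationOfNeZeroMod n (x : Kˣ ⧸ (powMonoidHom n : Kˣ →* Kˣ).range) =
          (Int.quotientZMultiplesNatEquivZMod n).toMultiplicative
            ((v.valuationOfNeZero x : Multiplicative ℤ) :
              Multiplicative ℤ ⧸ AddSubgroup.toSubgroup (AddSubgroup.zmultiples (n : ℤ))) := rfl
      rw [key] at h1
      have h2 : ((v.valuationOfNeZero x : Multiplicative ℤ) :
          Multiplicative ℤ ⧸ AddSubgroup.toSubgroup (AddSubgroup.zmultiples (n : ℤ))) = 1 :=
        (Int.quotientZMultiplesNatEquivZMod n).toMultiplicative.injective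
          (h1.trans (map_one (Int.quotientZMultiplesNatEquivZMod n).toMultiplicative).symm)
      have h3 := (QuotientGroup.eq_one_iff _).mp h2
      have h4 : Multiplicative.toAdd (v.valuationOfNeZero x) ∈ AddSubgroup.zmultiples (n : ℤ) :=
        h3
      rw [Int.mem_zmultiples_iff, toAdd_valuationOfNeZero_eq_neg_count, dvd_neg] at h4
      exact h4
    obtain ⟨y, hy⟩ := exists_pow_eq_of_forall_dvd_count hn hcop hU x hdiv
    exact ⟨y, by rw [powMonoidHom_apply, hy]⟩

end Dedekind

section NumberField

open NumberField NumberField.Units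

/-- At unit rank zero every unit is a root of unity, so if `n` is prime to the number of roots of
unity the unit group is `n`-divisible. -/
theorem NumberField.units_pow_surjective_of_rank_eq_zero (K : Type*) [Field K] [NumberField K]
    {n : ℕ} (hrank : rank K = 0) (hw : (torsionOrder K).Coprime n) (u : (𝓞 K)ˣ) :
    ∃ w : (𝓞 K)ˣ, w ^ n = u := by
  obtain ⟨⟨ζ, e⟩, hζ, -⟩ := exist_unique_eq_mul_prod K u
  haveI : IsEmpty (Fin (rank K)) := ⟨fun i => by have := i.2; omega⟩
  rw [Fintype.prod_empty, mul_one] at hζ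
  refine ⟨((powCoprime (G := torsion K) hw).symm ζ : torsion K), ?_⟩
  rw [← Subgroup.coe_pow, ← powCoprime_apply hw, Equiv.apply_symm_apply, ← hζ]

/-- **Selmer scarcity at unit rank zero** (Lemma B of the note).  Let `K` be a number field with
unit rank `0` (i.e. `K = ℚ` or `K` imaginary quadratic) and `n ≥ 1` prime to the class number
and to the number of roots of unity of `K`.  Then the Selmer group `K(∅, n)` is trivial:
an element of `Kˣ` all of whose valuations are divisible by `n` is an `n`-th power. -/
theorem NumberField.selmerGroup_empty_eq_bot_of_rank_eq_zero (K : Type*) [Field K]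
    [NumberField K] {n : ℕ} (hn : 0 < n) (hrank : rank K = 0)
    (hh : (classNumber K).Coprime n) (hw : (torsionOrder K).Coprime n) :
    IsDedekindDomain.selmerGroup (R := 𝓞 K) (K := K)
      (S := (∅ : Set (HeightOneSpectrum (𝓞 K)))) (n := n) = ⊥ := by
  refine selmerGroup_empty_eq_bot hn ?_ (NumberField.units_pow_surjective_of_rank_eq_zero K hrank hw)
  rwa [Nat.card_eq_fintype_card]

/-- The same statement on elements of `Kˣ`. -/
theorem NumberField.exists_pow_eq_of_rank_eq_zero (K : Type*) [Field K] [NumberField K]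
    {n : ℕ} (hn : 0 < n) (hrank : rank K = 0) (hh : (classNumber K).Coprime n)
    (hw : (torsionOrder K).Coprime n) (x : Kˣ)
    (h : ∀ v : HeightOneSpectrum (𝓞 K), (n : ℤ) ∣ count K v (spanSingleton (𝓞 K)⁰ (x : K))) :
    ∃ y : Kˣ, y ^ n = x :=
  exists_pow_eq_of_forall_dvd_count hn (by rwa [Nat.card_eq_fintype_card])
    (NumberField.units_pow_surjective_of_rank_eq_zero K hrank hw) x h

end NumberField

end Summit.Langlands.Langlands.Theorems
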